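import Literature.Topology.FourManifolds.MMSWBeltTwistInvarianceProofs
import Literature.Topology.FourManifolds.MMSWEventualRasmussenReduction
import HarnessLib

/-!
# `eventually_approxHasRasmussen_multiIndex`: reduction to the stability of multi-count strip-twisted pictures

Second sibling proof file of `Literature/Topology/FourManifolds/MMSWBeltTwistInvariance.lean`
(named fact `Literature.Topology.FourManifolds.eventually_approxHasRasmussen_multiIndex`:
C. Manolescu, M. Marengon, S. Sarkar, M. Willis, *A generalization of Rasmussen's invariant, with
applications to surfaces in some four-manifolds*, Duke Math. J. 172 (2023) 231–311,
arXiv:1910.08195, Thm. 3.7 with Thm. 3.3), after `MMSWBeltTwistInvarianceProofs.lean`, and the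
multi-index companion of `MMSWEventualRasmussenReduction.lean` (the same reduction for the
diagonal fact `MMSW.eventually_approxHasRasmussen`, [MMSW] Thm. 1.4).  The fact is NOT discharged
here; this file pins BOTH facts to ONE input, stated in the objects of the read-off line
`MMSWStripTwist` → `MMSWTwistedPicture*` → `MMSWTwistedPictureGaussDiagram`.

* `MMSW.stripTwistAtMulti r κ w e` (`κ ∈ ℤʳ`) — the offset strip twist of `MMSWStripTwist` with
  its own number `κ_j` of full twists across the band above the `j`-th hole; for the constant
  multi-count `(k, …, k)` it is LITERALLY `MMSW.stripTwistAt r k w e` (`stripTwistAtMulti_const`,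
  `rfl`), so every theorem below specialises to the diagonal line verbatim;
* `MMSW.stripFamilyAtMulti` — the smooth family of unit multipliers from the belt multiplier
  `Π_j u_j^{κ_j}` (`MMSW.beltMultiplier`, the twist `τ^κ = Π_j σ_j^{κ_j}` of the fact) to the
  multi-count strip multiplier (`stripFamilyAtMulti_zero`, `stripFamilyAtMulti_one`,
  `contDiffAt_stripFamilyAtMulti`), whence (`MMSWFibreRotation`) **`τ^κ ∘ K` is smoothly isotopic
  through core-missing model knots to `stripTwistAtMulti r κ w e ∘ K`**
  (`isSmoothModelIsotopy_beltTwist_stripTwistAtMulti`) and, for a core-missing model knot,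
  **`s(D(k⃗)(τ^ε ∘ K)) = s(D(0⃗)(stripTwistAtMulti r (ε + k⃗) w e ∘ K))`**
  (`approxHasRasmussen_beltTwist_comp_iff_stripTwistAtMulti_add`): MMSW's multi-index diagram
  `D(k⃗ + ε)` of `K` is the untwisted picture of the knot with `k + ε_j` full twists inserted across
  the `j`-th band — the explicit form of [MMSW] §2.1, Fig. InsertTwists, in the tree's picture;
* **the reduction** (`eventually_approxHasRasmussen_multiIndex_of_multiStripStable`): the named
  fact follows from Reidemeister's theorem (uniqueness of the Rasmussen invariant of a knot in
  `S³`, the tree's fact `Knot.reidemeister`, through `ApproxHasRasmussen.unique`) and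
  **multi-count strip stability** — for every `r ≥ 1` and every core-missing null-homologous model
  knot `K ⊂ M_r` there are admissible offset bands `(w, e)`, a value `s` and a threshold `k₀` with
  `s(D(0⃗)(stripTwistAtMulti r κ w e ∘ K)) = s` for ALL multi-counts `κ` with `κ_j ≥ k₀` for every
  `j` — which is [MMSW] Thm. 3.3 in its multi-index form (Willis 2021, Thm. 1.1: the Khovanov
  complexes of the `D(k⃗)` stabilise in each index separately; [MMSW] Cor. 2.2, Thm. 2.5, and the
  proof of Thm. 2.8: "`σ_i` simply adds a full twist … changing `k` to `k ± 1`"); the squeeze is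
  `s(D(k⃗ + ε)) = s = s(D(k⃗))` once `k ≥ k₀ + Σ_j |ε_j|`.  The SAME hypothesis gives the diagonal
  fact with no further input (`eventually_approxHasRasmussen_of_multiStripStable`, through
  `eventually_approxHasRasmussen_of_stripStableAt`), and [MMSW] Thm. 3.7 for the belt twists of
  the knots concerned (`hasSMinus_beltTwist_comp_of_multiStripStable`);
* the same reductions with the input required only for knots whose picture `D(0⃗)(K)` is a tree
  knot in general position (`…_inGeneralPosition`, via
  `IsModelKnot.exists_isotopy_inGeneralPosition` — the isotopy to general position misses the
  cores, so it transports `τ^ε` as well, `approxHasRasmussen_beltTwist_comp_iff_of_isotopy`).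

So what remains for the named fact is: (i) Reidemeister's theorem for the tree's Gauss diagrams
(`Knot.reidemeister`, needed only to compare two values of `s` of one knot in `S³`), and (ii) the
stabilisation of the Rasmussen invariants of the explicit multi-count twisted pictures — the
diagonal case of (ii) being exactly the open input of `MMSW.eventually_approxHasRasmussen`
(`MMSWTwistedPictureGaussDiagram.eventually_approxHasRasmussen_of_twistedDiagramStable`).
Everything here is proved; no named fact is introduced.

## References

* C. Manolescu, M. Marengon, S. Sarkar, M. Willis, Duke Math. J. 172 (2023) 231–311,
  arXiv:1910.08195: §2.1 (`D(k⃗)`, `k⃗ ∈ ℤʳ`, Fig. InsertTwists), Cor. 2.2, Thm. 2.5, §2.3 and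
  Thm. 2.8 (proof), Thm. 3.3, Thm. 3.7, Prop. 8.2 (i), §8.1. [ManolescuMarengonSarkarWillis2023]
* M. Willis, *Khovanov homology for links in `#ʳ(S² × S¹)`*, Michigan Math. J. 70 (2021)
  675–748, arXiv:1812.06584, Thm. 1.1 (multi-index stabilisation). [folklore]
* M. W. Hirsch, *Differential Topology* (1976), Ch. 8 §1, Thm. 1.3 (isotopy extension; the tree's
  `approxHasRasmussen_iff_of_isotopy`). [HirschDT1976]
-/

open scoped Manifold ContDiff Topology ComplexConjugate Real
open Function Set Complex

noncomputable section

namespace Literature.Topology.FourManifolds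

/-- Local notation: `𝔼 n` is the model Euclidean space `EuclideanSpace ℝ (Fin n)`. -/
local notation "𝔼 " n:arg => EuclideanSpace ℝ (Fin n)

/-- Local notation: `𝕊 n` is the unit sphere in `EuclideanSpace ℝ (Fin (n + 1))`. -/
local notation "𝕊 " n:arg => (Metric.sphere (0 : EuclideanSpace ℝ (Fin (n + 1))) 1)

namespace MMSW

open Literature.AlgebraicTopology.Homotopy.HopfFibration (zC wC ofZW zC_ofZW wC_ofZW ofZW_zC_wC)
open Literature.Analysis.SpecialFunctions (contDiffAt_arg_of_mem_slitPlane)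

variable {r : ℕ}

/-! ## Multi-count offset strip twists -/

/-- **The multi-count offset strip multiplier** `Π_j stripUnit κ_j w (z - c_j - e_j)`: `κ_j` full
turns across the band of half-width `w` centred at `c_j + e_j` above the `j`-th hole.
[cite: ManolescuMarengonSarkarWillis2023, §2.1] -/
def stripMultiplierAtMulti (r : ℕ) (κ : Fin r → ℤ) (w : ℝ) (e : Fin r → ℝ) (z : ℂ) : ℂ :=
  ∏ j : Fin r, stripUnit (κ j) w (z - holeCentre r j - e j)

/-- **The multi-count offset strip twist** `(z, w) ↦ (z, w · Π_j stripUnit κ_j w (z - c_j - e_j))`: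
`κ_j` full twists of the strands through the disc spanned by the top circle of the `j`-th dotted
circle's tube — the model form of MMSW's multi-index insertion `D ↦ D(κ)`, `κ ∈ ℤʳ`.
[cite: ManolescuMarengonSarkarWillis2023, §2.1 and §2.3] -/
def stripTwistAtMulti (r : ℕ) (κ : Fin r → ℤ) (w : ℝ) (e : Fin r → ℝ) : 𝔼 4 → 𝔼 4 :=
  fibreRot (stripMultiplierAtMulti r κ w e)

/-- **The multi-count offset strip family** `Φ_a(z) = Π_j u_j(z)^{κ_j} ·
e^{i a Σ_j κ_j (stripLog w (z - c_j - e_j) - arg((z - c_j)/(z - c_j - e_j)))}`: from the belt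
multiplier `Π_j u_j^{κ_j}` (`a = 0`) to the multi-count offset strip multiplier (`a = 1`).
[folklore] -/
def stripFamilyAtMulti (r : ℕ) (κ : Fin r → ℤ) (w : ℝ) (e : Fin r → ℝ) (a : ℝ) (z : ℂ) : ℂ :=
  beltMultiplier r κ z * exp (((a * ∑ j : Fin r, (κ j : ℝ) *
    (stripLog w (z - holeCentre r j - e j) -
      arg ((z - holeCentre r j) / (z - holeCentre r j - e j))) : ℝ) : ℂ) * I)

/-- For the constant multi-count `(k, …, k)` the multi-count strip multiplier is the tree's offset
strip multiplier, literally. [folklore] -/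
theorem stripMultiplierAtMulti_const (r : ℕ) (k : ℤ) (w : ℝ) (e : Fin r → ℝ) :
    stripMultiplierAtMulti r (fun _ ↦ k) w e = stripMultiplierAt r k w e :=
  rfl

/-- **For the constant multi-count `(k, …, k)` the multi-count strip twist is the tree's
`stripTwistAt r k w e`, literally** — so the diagonal read-off line is the special case of
everything below. [folklore] -/
theorem stripTwistAtMulti_const (r : ℕ) (k : ℤ) (w : ℝ) (e : Fin r → ℝ) :
    stripTwistAtMulti r (fun _ ↦ k) w e = stripTwistAt r k w e :=
  rfl

/-- The multi-count strip multiplier has modulus one. [folklore] -/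
theorem norm_stripMultiplierAtMulti (r : ℕ) (κ : Fin r → ℤ) (w : ℝ) (e : Fin r → ℝ) (z : ℂ) :
    ‖stripMultiplierAtMulti r κ w e z‖ = 1 := by
  rw [stripMultiplierAtMulti, norm_prod]
  exact Finset.prod_eq_one fun j _ ↦ norm_stripUnit _ _ _

/-- At `a = 0` the multi-count strip family is the belt multiplier `Π_j u_j^{κ_j}`. [folklore] -/
theorem stripFamilyAtMulti_zero (r : ℕ) (κ : Fin r → ℤ) (w : ℝ) (e : Fin r → ℝ) :
    stripFamilyAtMulti r κ w e 0 = beltMultiplier r κ := by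
  funext z
  simp [stripFamilyAtMulti]

/-- The multi-count strip family consists of units away from the hole centres. [folklore] -/
theorem norm_stripFamilyAtMulti {z : ℂ} (hz : ∀ j : Fin r, z ≠ holeCentre r j) (κ : Fin r → ℤ)
    (w : ℝ) (e : Fin r → ℝ) (a : ℝ) : ‖stripFamilyAtMulti r κ w e a z‖ = 1 := by
  rw [stripFamilyAtMulti, norm_mul, norm_beltMultiplier hz, one_mul, Complex.norm_exp_ofReal_mul_I]

/-- **At `a = 1` the multi-count strip family is the multi-count strip multiplier** (at points
with `|z - c_j| ≥ 1`, `|e_j| < 1`): `Π_j u_j^{κ_j} · Π_j (stripUnit_j · u_j^{-κ_j}) = Π_j stripUnit_j`.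
[folklore] -/
theorem stripFamilyAtMulti_one {z : ℂ} (hz1 : ∀ j : Fin r, (1 : ℝ) ≤ ‖z - holeCentre r j‖)
    (κ : Fin r → ℤ) (w : ℝ) {e : Fin r → ℝ} (he : ∀ j, |e j| < 1) :
    stripFamilyAtMulti r κ w e 1 z = stripMultiplierAtMulti r κ w e z := by
  have hzj : ∀ j : Fin r, z - holeCentre r j ≠ 0 := fun j h ↦ by
    have := hz1 j
    rw [h, norm_zero] at this
    exact absurd this (by norm_num)
  have hz : ∀ j : Fin r, z ≠ holeCentre r j := fun j h ↦ hzj j (sub_eq_zero.2 h)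
  have hzje : ∀ j : Fin r, z - holeCentre r j - e j ≠ 0 := fun j h ↦ by
    have h' : z - holeCentre r j = e j := sub_eq_zero.1 h
    have := hz1 j
    rw [h', Complex.norm_real, Real.norm_eq_abs] at this
    linarith [he j]
  -- each summand exponentiates to `stripUnit_j · u_j^{-κ_j}`
  have hterm : ∀ j : Fin r, exp (((((κ j : ℝ) * (stripLog w (z - holeCentre r j - e j) -
      arg ((z - holeCentre r j) / (z - holeCentre r j - e j)))) : ℝ) : ℂ) * I) =
      stripUnit (κ j) w (z - holeCentre r j - e j) * holeUnit r j z ^ (-(κ j)) := by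
    intro j
    have hsplit : (((((κ j : ℝ) * (stripLog w (z - holeCentre r j - e j) -
        arg ((z - holeCentre r j) / (z - holeCentre r j - e j)))) : ℝ) : ℂ) * I) =
        (((κ j) * stripLog w (z - holeCentre r j - e j) : ℝ) : ℂ) * I +
          (-(κ j) : ℂ) * (((arg ((z - holeCentre r j) / (z - holeCentre r j - e j)) : ℝ) : ℂ) * I) := by
      push_cast
      ring
    rw [hsplit, Complex.exp_add, exp_mul_stripLog (hzje j),
      show (-(κ j : ℂ)) = ((-κ j : ℤ) : ℂ) by push_cast; ring, Complex.exp_int_mul, mul_assoc,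
      ← mul_zpow]
    congr 2
    rw [mul_comm]
    exact exp_arg_div_sub_mul (hzj j) (hzje j)
  rw [stripFamilyAtMulti, one_mul, Complex.ofReal_sum, Finset.sum_mul, Complex.exp_sum]
  simp_rw [hterm]
  rw [Finset.prod_mul_distrib, stripMultiplierAtMulti, beltMultiplier]
  simp_rw [zpow_neg]
  rw [Finset.prod_inv_distrib, mul_left_comm, mul_inv_cancel₀
    (Finset.prod_ne_zero_iff.2 fun j _ ↦ zpow_ne_zero _ (holeUnit_ne_zero (hz j))), mul_one]

/-- **The multi-count strip family is jointly smooth in `(a, z)`** at every `z` of the planar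
domain, for offsets with `|e_j| + w < 1`. [folklore] -/
theorem contDiffAt_stripFamilyAtMulti {z : ℂ} (hz1 : ∀ j : Fin r, (1 : ℝ) ≤ ‖z - holeCentre r j‖)
    (κ : Fin r → ℤ) {w : ℝ} (hw : 0 < w) {e : Fin r → ℝ} (he : ∀ j, |e j| + w < 1) (a : ℝ) :
    ContDiffAt ℝ ∞ (uncurry (stripFamilyAtMulti r κ w e)) (a, z) := by
  have he1 : ∀ j, |e j| < 1 := fun j ↦ by linarith [he j]
  have hz : ∀ j : Fin r, z ≠ holeCentre r j := fun j h ↦ by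
    have := hz1 j
    rw [h, sub_self, norm_zero] at this
    exact absurd this (by norm_num)
  have hzje : ∀ j : Fin r, z - holeCentre r j - e j ≠ 0 := fun j h ↦ by
    have h' : z - holeCentre r j = e j := sub_eq_zero.1 h
    have := hz1 j
    rw [h', Complex.norm_real, Real.norm_eq_abs] at this
    linarith [he1 j]
  have hb : ContDiffAt ℝ ∞ (fun p : ℝ × ℂ ↦ beltMultiplier r κ p.2) (a, z) :=
    ContDiffAt.comp (g := beltMultiplier r κ) (f := (Prod.snd : ℝ × ℂ → ℂ)) (a, z)
      (contDiffAt_beltMultiplier hz κ) contDiffAt_snd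
  -- the smooth summands
  have hsum : ∀ j : Fin r, ContDiffAt ℝ ∞ (fun y : ℂ ↦ stripLog w (y - holeCentre r j - e j) -
      arg ((y - holeCentre r j) / (y - holeCentre r j - e j))) z := by
    intro j
    have hL : ContDiffAt ℝ ∞ (fun y : ℂ ↦ stripLog w (y - holeCentre r j - e j)) z := by
      have hoff := off_band_of_one_le_norm (hz1 j) (he j)
      have h := contDiffAt_stripLog_of_off_band hw (ζ := z - holeCentre r j - e j)
        (by simpa [sub_sub] using hoff)
      exact h.comp z ((contDiffAt_id.sub contDiffAt_const).sub contDiffAt_const)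
    have hq : ContDiffAt ℝ ∞ (fun y : ℂ ↦ (y - holeCentre r j) / (y - holeCentre r j - e j)) z := by
      simp_rw [div_eq_mul_inv]
      exact (contDiffAt_id.sub contDiffAt_const).mul
        (((contDiffAt_id.sub contDiffAt_const).sub contDiffAt_const).inv (hzje j))
    have hA : ContDiffAt ℝ ∞
        (fun y : ℂ ↦ arg ((y - holeCentre r j) / (y - holeCentre r j - e j))) z := by
      have h := ContDiffAt.comp (g := arg) z
        (contDiffAt_arg_of_mem_slitPlane (div_sub_mem_slitPlane (hz1 j) (he1 j))) hq
      exact h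
    exact hL.sub hA
  have hL : ContDiffAt ℝ ∞ (fun y : ℂ ↦ ∑ j : Fin r, (κ j : ℝ) *
      (stripLog w (y - holeCentre r j - e j) -
        arg ((y - holeCentre r j) / (y - holeCentre r j - e j)))) z :=
    ContDiffAt.sum fun j _ ↦ contDiffAt_const.mul (hsum j)
  have hL2 := hL.comp (a, z) (contDiffAt_snd : ContDiffAt ℝ ∞ (Prod.snd : ℝ × ℂ → ℂ) (a, z))
  have hph : ContDiffAt ℝ ∞ (fun p : ℝ × ℂ ↦ p.1 * ∑ j : Fin r, (κ j : ℝ) *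
      (stripLog w (p.2 - holeCentre r j - e j) -
        arg ((p.2 - holeCentre r j) / (p.2 - holeCentre r j - e j)))) (a, z) :=
    contDiffAt_fst.mul hL2
  have hexp : ContDiffAt ℝ ∞ (fun p : ℝ × ℂ ↦ exp (((p.1 * ∑ j : Fin r, (κ j : ℝ) *
      (stripLog w (p.2 - holeCentre r j - e j) -
        arg ((p.2 - holeCentre r j) / (p.2 - holeCentre r j - e j))) : ℝ) : ℂ) * I)) (a, z) :=
    (Complex.contDiff_exp.contDiffAt).comp (a, z)
      (((Complex.ofRealCLM.contDiff.contDiffAt).comp (a, z) hph).mul contDiffAt_const)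
  exact hb.mul hexp

/-- **The multi-count strip multiplier is `1` off the bands.** [folklore] -/
theorem stripMultiplierAtMulti_eq_one {κ : Fin r → ℤ} {w : ℝ} (hw : 0 < w) {e : Fin r → ℝ}
    {z : ℂ} (hoff : ∀ j : Fin r, z.im ≤ 0 ∨ w ≤ |z.re - (holeCentre r j).re - e j|) :
    stripMultiplierAtMulti r κ w e z = 1 := by
  refine Finset.prod_eq_one fun j _ ↦ stripUnit_eq_one hw ?_
  rcases hoff j with h | h
  · left; simpa [holeCentre] using h
  · right; simpa using h

/-- **The multi-count strip twist is the identity off the bands.** [folklore] -/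
theorem stripTwistAtMulti_eq_self {κ : Fin r → ℤ} {w : ℝ} (hw : 0 < w) {e : Fin r → ℝ}
    {x : 𝔼 4} (hoff : ∀ j : Fin r, (zC x).im ≤ 0 ∨ w ≤ |(zC x).re - (holeCentre r j).re - e j|) :
    stripTwistAtMulti r κ w e x = x :=
  fibreRot_of_apply_eq_one (stripMultiplierAtMulti_eq_one hw hoff)

/-- `z` is unchanged by the multi-count strip twist. [folklore] -/
@[simp] theorem zC_stripTwistAtMulti (κ : Fin r → ℤ) (w : ℝ) (e : Fin r → ℝ) (x : 𝔼 4) :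
    zC (stripTwistAtMulti r κ w e x) = zC x := by
  rw [stripTwistAtMulti, zC_fibreRot]

/-- The multi-count strip twist keeps points off the cores. [folklore] -/
theorem wC_stripTwistAtMulti_ne_zero (κ : Fin r → ℤ) (w : ℝ) (e : Fin r → ℝ) {x : 𝔼 4}
    (hx : wC x ≠ 0) : wC (stripTwistAtMulti r κ w e x) ≠ 0 := by
  rw [stripTwistAtMulti, wC_fibreRot]
  exact mul_ne_zero hx (norm_ne_zero_iff.1 (by rw [norm_stripMultiplierAtMulti]; exact one_ne_zero))

/-- The fibre rotation by the start of the multi-count strip family is the belt twist `τ^κ`.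
[folklore] -/
theorem fibreRot_stripFamilyAtMulti_zero (r : ℕ) (κ : Fin r → ℤ) (w : ℝ) (e : Fin r → ℝ) :
    fibreRot (stripFamilyAtMulti r κ w e 0) = beltTwist r κ := by
  rw [stripFamilyAtMulti_zero]
  rfl

/-- On a model knot the end of the multi-count strip family is the multi-count strip twist.
[folklore] -/
theorem fibreRot_stripFamilyAtMulti_one_comp {K : 𝕊 1 → 𝔼 4} (hK : IsModelKnot r K)
    (κ : Fin r → ℤ) (w : ℝ) {e : Fin r → ℝ} (he : ∀ j, |e j| < 1) :
    fibreRot (stripFamilyAtMulti r κ w e 1) ∘ K = stripTwistAtMulti r κ w e ∘ K := by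
  funext t
  show fibreRot (stripFamilyAtMulti r κ w e 1) (K t) = fibreRot (stripMultiplierAtMulti r κ w e) (K t)
  simp only [fibreRot, stripFamilyAtMulti_one (one_le_norm_zC_sub_holeCentre (hK.mem t).1) κ w he]

/-- **The multi-count strip twist of a model knot is a model knot** (a fibre rotation by a smooth
unit multiplier). [cite: ManolescuMarengonSarkarWillis2023, §2.1] -/
theorem IsModelKnot.stripTwistAtMulti_comp {K : 𝕊 1 → 𝔼 4} (hK : IsModelKnot r K)
    (κ : Fin r → ℤ) {w : ℝ} (hw : 0 < w) {e : Fin r → ℝ} (he : ∀ j, |e j| + w < 1) :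
    IsModelKnot r (stripTwistAtMulti r κ w e ∘ K) := by
  have he1 : ∀ j, |e j| < 1 := fun j ↦ by linarith [he j]
  have hz : ∀ t, ∀ j : Fin r, zC (K t) ≠ holeCentre r j := fun t ↦ zC_ne_holeCentre (hK.mem t).1
  rw [← fibreRot_stripFamilyAtMulti_one_comp hK κ w he1]
  refine hK.fibreRot_comp (fun t ↦ ?_) (fun t ↦ norm_stripFamilyAtMulti (hz t) κ w e 1)
  have h := contDiffAt_stripFamilyAtMulti (one_le_norm_zC_sub_holeCentre (hK.mem t).1) κ hw he 1
  exact h.comp (zC (K t)) (contDiffAt_const.prodMk contDiffAt_id)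

/-- The multi-count strip twists do not move `z`, so they preserve null-homology. [folklore] -/
theorem isNullHomologous_stripTwistAtMulti_comp_iff (K : 𝕊 1 → 𝔼 4) (κ : Fin r → ℤ) (w : ℝ)
    (e : Fin r → ℝ) : IsNullHomologous r (stripTwistAtMulti r κ w e ∘ K) ↔ IsNullHomologous r K := by
  simp only [IsNullHomologous, Function.comp_apply, zC_stripTwistAtMulti]

/-! ## The belt twist `τ^κ` versus the multi-count strip twist on model knots -/

/-- **`τ^κ ∘ K` is smoothly isotopic, through model knots, to `stripTwistAtMulti r κ w e ∘ K`**
(the multi-count strip family is a smooth family of unit multipliers, `MMSWFibreRotation`).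
[cite: ManolescuMarengonSarkarWillis2023, §2.3] -/
theorem isSmoothModelIsotopy_beltTwist_stripTwistAtMulti {K : 𝕊 1 → 𝔼 4} (hK : IsModelKnot r K)
    (κ : Fin r → ℤ) {w : ℝ} (hw : 0 < w) {e : Fin r → ℝ} (he : ∀ j, |e j| + w < 1) :
    IsSmoothModelIsotopy r (beltTwist r κ ∘ K) (stripTwistAtMulti r κ w e ∘ K) := by
  have he1 : ∀ j, |e j| < 1 := fun j ↦ by linarith [he j]
  have hz : ∀ t, ∀ j : Fin r, zC (K t) ≠ holeCentre r j := fun t ↦ zC_ne_holeCentre (hK.mem t).1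
  have h := isSmoothModelIsotopy_fibreRot hK (Φ := stripFamilyAtMulti r κ w e)
    (fun a t ↦ contDiffAt_stripFamilyAtMulti (one_le_norm_zC_sub_holeCentre (hK.mem t).1) κ hw he a)
    (fun a t ↦ norm_stripFamilyAtMulti (hz t) κ w e a)
  rwa [fibreRot_stripFamilyAtMulti_zero, fibreRot_stripFamilyAtMulti_one_comp hK κ w he1] at h

/-- `s₋` of the multi-count strip-twisted knot is `s₋` of the belt-twisted knot `τ^κ ∘ K` (isotopy
invariance of `s₋`). [cite: ManolescuMarengonSarkarWillis2023, Thm. 1.3] -/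
theorem hasSMinus_stripTwistAtMulti_comp_iff {K : 𝕊 1 → 𝔼 4} (hK : IsModelKnot r K)
    (κ : Fin r → ℤ) {w : ℝ} (hw : 0 < w) {e : Fin r → ℝ} (he : ∀ j, |e j| + w < 1) (s : ℤ) :
    HasSMinus r (stripTwistAtMulti r κ w e ∘ K) s ↔ HasSMinus r (beltTwist r κ ∘ K) s :=
  ((isSmoothModelIsotopy_beltTwist_stripTwistAtMulti hK κ hw he).isModelIsotopic.hasSMinus_iff s).symm

/-- **The Rasmussen invariants of every finite approximation of `τ^κ ∘ K` and of
`stripTwistAtMulti r κ w e ∘ K` agree**, for a core-missing model knot `K` (the isotopy between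
them stays off the cores, so it is an isotopy of each picture in `S³`).
[cite: HirschDT1976, Ch. 8 §1, Thm. 1.3] -/
theorem approxHasRasmussen_beltTwist_comp_iff_stripTwistAtMulti {K : 𝕊 1 → 𝔼 4}
    (hK : IsModelKnot r K) (hwK : ∀ t, wC (K t) ≠ 0) (κ : Fin r → ℤ) {w : ℝ} (hw : 0 < w)
    {e : Fin r → ℝ} (he : ∀ j, |e j| + w < 1) (k : ℤ) (s : ℤ) :
    ApproxHasRasmussen r k (beltTwist r κ ∘ K) s ↔
      ApproxHasRasmussen r k (stripTwistAtMulti r κ w e ∘ K) s := by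
  have he1 : ∀ j, |e j| < 1 := fun j ↦ by linarith [he j]
  have hz : ∀ t, ∀ j : Fin r, zC (K t) ≠ holeCentre r j := fun t ↦ zC_ne_holeCentre (hK.mem t).1
  have h := approxHasRasmussen_fibreRot_iff_of_family hK hwK (Φ := stripFamilyAtMulti r κ w e)
    (fun a t ↦ contDiffAt_stripFamilyAtMulti (one_le_norm_zC_sub_holeCentre (hK.mem t).1) κ hw he a)
    (fun a t ↦ norm_stripFamilyAtMulti (hz t) κ w e a) k s
  rwa [fibreRot_stripFamilyAtMulti_zero, fibreRot_stripFamilyAtMulti_one_comp hK κ w he1] at h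

/-- **MMSW's multi-index diagram `D(k⃗ + ε)(K)` in the model**: for a core-missing model knot `K`
and `ε ∈ ℤʳ`, the Rasmussen invariants of `D(k⃗)(τ^ε ∘ K)` are those of the untwisted picture
`D(0⃗)` of `stripTwistAtMulti r (ε + k⃗) w e ∘ K` — the knot with `ε_j + k` full twists inserted
across the band above the `j`-th hole (`σ^k ∘ τ^ε = τ^{ε + k⃗}`, then the isotopy to the bands).
[cite: ManolescuMarengonSarkarWillis2023, §2.1 and Thm. 2.8 (proof)] -/
theorem approxHasRasmussen_beltTwist_comp_iff_stripTwistAtMulti_add {K : 𝕊 1 → 𝔼 4}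
    (hK : IsModelKnot r K) (hwK : ∀ t, wC (K t) ≠ 0) (ε : Fin r → ℤ) {w : ℝ} (hw : 0 < w)
    {e : Fin r → ℝ} (he : ∀ j, |e j| + w < 1) (k : ℤ) (s : ℤ) :
    ApproxHasRasmussen r k (beltTwist r ε ∘ K) s ↔
      ApproxHasRasmussen r 0 (stripTwistAtMulti r (ε + fun _ ↦ k) w e ∘ K) s := by
  have h1 : ApproxHasRasmussen r k (beltTwist r ε ∘ K) s ↔
      ApproxHasRasmussen r 0 (beltTwist r (fun _ ↦ k) ∘ (beltTwist r ε ∘ K)) s := by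
    rw [approxHasRasmussen_beltTwist_const_comp_iff (fun t ↦ (hK.beltTwist_comp ε).mem t), add_zero]
  rw [h1, beltTwist_comp_beltTwist_comp hK.mem ε (fun _ ↦ k)]
  exact approxHasRasmussen_beltTwist_comp_iff_stripTwistAtMulti hK hwK (ε + fun _ ↦ k) hw he 0 s

/-- The diagonal case: `s(D(k⃗)(K)) = s(D(0⃗)(stripTwistAtMulti r (k, …, k) w e ∘ K))` — the tree's
`approxHasRasmussen_iff_stripTwistAt` read through `stripTwistAtMulti_const`.
[cite: ManolescuMarengonSarkarWillis2023, §2.1 and Prop. 8.2 (i)] -/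
theorem approxHasRasmussen_iff_stripTwistAtMulti_const {K : 𝕊 1 → 𝔼 4} (hK : IsModelKnot r K)
    (hwK : ∀ t, wC (K t) ≠ 0) {w : ℝ} (hw : 0 < w) {e : Fin r → ℝ} (he : ∀ j, |e j| + w < 1)
    (k : ℤ) (s : ℤ) :
    ApproxHasRasmussen r k K s ↔
      ApproxHasRasmussen r 0 (stripTwistAtMulti r (fun _ ↦ k) w e ∘ K) s := by
  have h := approxHasRasmussen_iff_stripTwistAt hK hwK k hw he 0 s
  rwa [add_zero] at h

/-- **`τ^ε` is transported by core-missing model isotopies, with all Rasmussen invariants of the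
finite approximations**: a collared jointly smooth family `H` of core-missing model knots from `K`
to `K'` gives the family `τ^ε ∘ H_s` from `τ^ε ∘ K` to `τ^ε ∘ K'`, again through core-missing model
knots, so `s(D(k⃗)(τ^ε ∘ K)) = s(D(k⃗)(τ^ε ∘ K'))` for every `k`.
[cite: HirschDT1976, Ch. 8 §1, Thm. 1.3] -/
theorem approxHasRasmussen_beltTwist_comp_iff_of_isotopy {K K' : 𝕊 1 → 𝔼 4}
    {H : ℝ → (𝕊 1) → 𝔼 4}
    (hH : ContMDiff (𝓘(ℝ, ℝ).prod (𝓡 1)) 𝓘(ℝ, 𝔼 4) ∞ (fun p : ℝ × (𝕊 1) ↦ H p.1 p.2))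
    (h0 : H 0 = K) (h1 : H 1 = K') (hmk : ∀ s, IsModelKnot r (H s)) (hw : ∀ s t, wC (H s t) ≠ 0)
    (ε : Fin r → ℤ) (k : ℤ) (s : ℤ) :
    ApproxHasRasmussen r k (beltTwist r ε ∘ K) s ↔ ApproxHasRasmussen r k (beltTwist r ε ∘ K') s := by
  refine approxHasRasmussen_iff_of_isotopy (H := fun a ↦ beltTwist r ε ∘ H a) (fun p ↦ ?_)
    (by rw [h0]) (by rw [h1]) (fun a ↦ (hmk a).beltTwist_comp ε)
    (fun a t ↦ wC_beltTwist_comp_ne_zero (hmk a) (hw a) ε t) k s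
  have hz : ∀ j : Fin r, zC (H p.1 p.2) ≠ holeCentre r j := zC_ne_holeCentre ((hmk p.1).mem p.2).1
  exact ((contDiffAt_beltTwist hz ε).contMDiffAt).comp p (hH p)

/-! ## Multi-count strip stability, and what it gives

The INPUT of the reductions, for ONE core-missing model knot `K ⊂ M_r` with admissible offset
bands `(w, e)` (`0 < w`, `|e_j| + w < 1`): a value `s₀` and a threshold `k₀` such that
`s(D(0⃗)(stripTwistAtMulti r κ w e ∘ K)) = s₀` for every multi-count `κ` with `κ_j ≥ k₀` for all
`j`.  It is recorded as a HYPOTHESIS of the theorems (never as a named fact). -/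

/-- **Multi-count strip stability gives [MMSW] Thm. 3.7 for the belt twists of `K`**: every
`τ^ε ∘ K`, `ε ∈ ℤʳ`, then has `s₋ = s₀`, with representative itself
(`s(D(k⃗)(τ^ε ∘ K)) = s(D(0⃗)(stripTwistAtMulti (ε + k⃗) ∘ K)) = s₀` for `k ≥ k₀ + Σ_j |ε_j|`).
[cite: ManolescuMarengonSarkarWillis2023, Thm. 3.7 and Thm. 3.3] -/
theorem hasSMinus_beltTwist_comp_of_multiStripStable {K : 𝕊 1 → 𝔼 4} (hK : IsModelKnot r K)
    (h0 : IsNullHomologous r K) (hwK : ∀ t, wC (K t) ≠ 0) {w : ℝ} (hw : 0 < w) {e : Fin r → ℝ}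
    (he : ∀ j, |e j| + w < 1) {s₀ k₀ : ℤ}
    (hk : ∀ κ : Fin r → ℤ, (∀ j, k₀ ≤ κ j) →
      ApproxHasRasmussen r 0 (stripTwistAtMulti r κ w e ∘ K) s₀)
    (ε : Fin r → ℤ) : HasSMinus r (beltTwist r ε ∘ K) s₀ := by
  refine ⟨(isNullHomologous_beltTwist_comp_iff K ε).2 h0, beltTwist r ε ∘ K,
    IsModelIsotopic.refl (hK.beltTwist_comp ε), wC_beltTwist_comp_ne_zero hK hwK ε,
    k₀ + ∑ j, |ε j|, fun k hkk ↦ ?_⟩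
  rw [approxHasRasmussen_beltTwist_comp_iff_stripTwistAtMulti_add hK hwK ε hw he k s₀]
  refine hk _ fun j ↦ ?_
  have h1 : |ε j| ≤ ∑ i, |ε i| :=
    Finset.single_le_sum (f := fun i ↦ |ε i|) (fun i _ ↦ abs_nonneg (ε i)) (Finset.mem_univ j)
  have h2 : -|ε j| ≤ ε j := neg_abs_le _
  simp only [Pi.add_apply]
  linarith

/-- **The squeeze, for one knot**: multi-count strip stability for `K` and Reidemeister's theorem
(uniqueness of the Rasmussen invariant of a knot in `S³`) give
`s(D(k⃗)(τ^ε ∘ K)) = s(D(k⃗)(K))` for all `k ≥ k₀ + Σ_j |ε_j|`: both are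
`s(D(0⃗)(stripTwistAtMulti κ ∘ K))` for the multi-counts `κ = ε + k⃗` and `κ = k⃗`, which are
beyond the threshold in every index. [cite: ManolescuMarengonSarkarWillis2023, Thm. 3.7 and Thm. 3.3] -/
theorem exists_forall_approxHasRasmussen_beltTwist_comp_iff_of_multiStripStable
    (hR : Knot.reidemeister) {K : 𝕊 1 → 𝔼 4} (hK : IsModelKnot r K) (hwK : ∀ t, wC (K t) ≠ 0)
    {w : ℝ} (hw : 0 < w) {e : Fin r → ℝ} (he : ∀ j, |e j| + w < 1) {s₀ k₀ : ℤ}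
    (hk : ∀ κ : Fin r → ℤ, (∀ j, k₀ ≤ κ j) →
      ApproxHasRasmussen r 0 (stripTwistAtMulti r κ w e ∘ K) s₀)
    (ε : Fin r → ℤ) :
    ∃ k₁ : ℤ, ∀ k : ℤ, k₁ ≤ k → ∀ s : ℤ,
      ApproxHasRasmussen r k (beltTwist r ε ∘ K) s ↔ ApproxHasRasmussen r k K s := by
  refine ⟨k₀ + ∑ j, |ε j|, fun k hkk s ↦ ?_⟩
  have hsum : (0 : ℤ) ≤ ∑ i, |ε i| := Finset.sum_nonneg fun i _ ↦ abs_nonneg (ε i)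
  have hκ₁ : ∀ j, k₀ ≤ (ε + fun _ ↦ k : Fin r → ℤ) j := fun j ↦ by
    have h1 : |ε j| ≤ ∑ i, |ε i| :=
      Finset.single_le_sum (f := fun i ↦ |ε i|) (fun i _ ↦ abs_nonneg (ε i)) (Finset.mem_univ j)
    have h2 : -|ε j| ≤ ε j := neg_abs_le _
    simp only [Pi.add_apply]
    linarith
  have hκ₂ : ∀ j : Fin r, k₀ ≤ (fun _ : Fin r ↦ k) j := fun j ↦ by
    show k₀ ≤ k
    linarith
  have hA : ApproxHasRasmussen r 0 (stripTwistAtMulti r (ε + fun _ ↦ k) w e ∘ K) s₀ := hk _ hκ₁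
  have hB : ApproxHasRasmussen r 0 (stripTwistAtMulti r (fun _ ↦ k) w e ∘ K) s₀ := hk _ hκ₂
  rw [approxHasRasmussen_beltTwist_comp_iff_stripTwistAtMulti_add hK hwK ε hw he k s,
    approxHasRasmussen_iff_stripTwistAtMulti_const hK hwK hw he k s]
  exact ⟨fun h ↦ by rw [h.unique hR hA]; exact hB, fun h ↦ by rw [h.unique hR hB]; exact hA⟩

/-! ## The reductions of both named facts to multi-count strip stability -/

/-- **The diagonal fact from multi-count strip stability** (constant multi-counts; no further
input): `MMSW.eventually_approxHasRasmussen` through `eventually_approxHasRasmussen_of_stripStableAt`.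
[cite: ManolescuMarengonSarkarWillis2023, Thm. 3.3 and Prop. 8.2 (i)] -/
theorem eventually_approxHasRasmussen_of_multiStripStable
    (h : ∀ {r : ℕ} {K : 𝕊 1 → 𝔼 4}, 0 < r → IsModelKnot r K → IsNullHomologous r K →
      (∀ t, wC (K t) ≠ 0) →
        ∃ (w : ℝ) (e : Fin r → ℝ) (s k₀ : ℤ), 0 < w ∧ (∀ j, |e j| + w < 1) ∧
          ∀ κ : Fin r → ℤ, (∀ j, k₀ ≤ κ j) →
            ApproxHasRasmussen r 0 (stripTwistAtMulti r κ w e ∘ K) s) :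
    eventually_approxHasRasmussen := by
  refine eventually_approxHasRasmussen_of_stripStableAt fun {r} {K} hr hK h0 hw ↦ ?_
  obtain ⟨w, e, s, k₀, hw0, he, hk⟩ := h hr hK h0 hw
  exact ⟨w, e, s, k₀, hw0, he, fun k hkk ↦ hk (fun _ ↦ k) fun _ ↦ hkk⟩

/-- **Reduction of `eventually_approxHasRasmussen_multiIndex` to multi-count strip stability and
Reidemeister's theorem.**  If for every `r ≥ 1` and every core-missing null-homologous model knot
`K ⊂ M_r` there are admissible offset bands `(w, e)`, a value `s` and a threshold `k₀` with
`s(D(0⃗)(stripTwistAtMulti r κ w e ∘ K)) = s` for all multi-counts `κ ≥ (k₀, …, k₀)` ([MMSW] Thm. 3.3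
in multi-index form — hypothesis `h`), then, given Reidemeister's theorem (`Knot.reidemeister`,
uniqueness of the Rasmussen invariant of a knot in `S³`), the Rasmussen invariants of
`D(k⃗)(τ^ε ∘ K) = D(k⃗ + ε)(K)` and of `D(k⃗)(K)` agree for all `k ≥ k₀ + Σ_j |ε_j|`; for `r = 0`
there is nothing to prove (`τ^ε = id`).
[cite: ManolescuMarengonSarkarWillis2023, Thm. 3.7, Thm. 3.3 and Thm. 2.8 (proof)] -/
theorem eventually_approxHasRasmussen_multiIndex_of_multiStripStable (hR : Knot.reidemeister)
    (h : ∀ {r : ℕ} {K : 𝕊 1 → 𝔼 4}, 0 < r → IsModelKnot r K → IsNullHomologous r K →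
      (∀ t, wC (K t) ≠ 0) →
        ∃ (w : ℝ) (e : Fin r → ℝ) (s k₀ : ℤ), 0 < w ∧ (∀ j, |e j| + w < 1) ∧
          ∀ κ : Fin r → ℤ, (∀ j, k₀ ≤ κ j) →
            ApproxHasRasmussen r 0 (stripTwistAtMulti r κ w e ∘ K) s) :
    eventually_approxHasRasmussen_multiIndex := by
  rw [eventually_approxHasRasmussen_multiIndex_iff]
  intro r K hK h0 hwK ε
  rcases Nat.eq_zero_or_pos r with rfl | hr
  · exact ⟨0, fun k _ s ↦ approxHasRasmussen_beltTwist_comp_iff_zero_left K ε k s⟩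
  obtain ⟨w, e, s₀, k₀, hw, he, hk⟩ := h hr hK h0 hwK
  exact exists_forall_approxHasRasmussen_beltTwist_comp_iff_of_multiStripStable hR hK hwK hw he hk ε

/-- **Both named facts at once** from multi-count strip stability (and Reidemeister's theorem for
the multi-index one). [cite: ManolescuMarengonSarkarWillis2023, Thm. 3.3 and Thm. 3.7] -/
theorem eventually_approxHasRasmussen_and_multiIndex_of_multiStripStable (hR : Knot.reidemeister)
    (h : ∀ {r : ℕ} {K : 𝕊 1 → 𝔼 4}, 0 < r → IsModelKnot r K → IsNullHomologous r K →
      (∀ t, wC (K t) ≠ 0) →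
        ∃ (w : ℝ) (e : Fin r → ℝ) (s k₀ : ℤ), 0 < w ∧ (∀ j, |e j| + w < 1) ∧
          ∀ κ : Fin r → ℤ, (∀ j, k₀ ≤ κ j) →
            ApproxHasRasmussen r 0 (stripTwistAtMulti r κ w e ∘ K) s) :
    eventually_approxHasRasmussen ∧ eventually_approxHasRasmussen_multiIndex :=
  ⟨eventually_approxHasRasmussen_of_multiStripStable h,
    eventually_approxHasRasmussen_multiIndex_of_multiStripStable hR h⟩

/-! ## The same reductions with the input required only in general position -/

/-- **The diagonal fact from multi-count strip stability in general position**: it suffices to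
know the input for core-missing null-homologous model knots `K` whose picture `D(0⃗)(K)` is a knot
of the tree in general position with respect to the stereographic projection
(`Knot.InGeneralPosition`). [cite: ManolescuMarengonSarkarWillis2023, Thm. 3.3, Prop. 8.2 (i) and §8.1] -/
theorem eventually_approxHasRasmussen_of_multiStripStable_inGeneralPosition
    (h : ∀ {r : ℕ} {K : 𝕊 1 → 𝔼 4}, 0 < r → IsModelKnot r K → IsNullHomologous r K →
      (∀ t, wC (K t) ≠ 0) → (∃ K₃ : Knot, ⇑K₃ = finiteApprox r 0 K ∧ K₃.InGeneralPosition) →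
        ∃ (w : ℝ) (e : Fin r → ℝ) (s k₀ : ℤ), 0 < w ∧ (∀ j, |e j| + w < 1) ∧
          ∀ κ : Fin r → ℤ, (∀ j, k₀ ≤ κ j) →
            ApproxHasRasmussen r 0 (stripTwistAtMulti r κ w e ∘ K) s) :
    eventually_approxHasRasmussen := by
  refine eventually_approxHasRasmussen_of_stripStableAt_inGeneralPosition
    fun {r} {K} hr hK h0 hw hgp ↦ ?_
  obtain ⟨w, e, s, k₀, hw0, he, hk⟩ := h hr hK h0 hw hgp
  exact ⟨w, e, s, k₀, hw0, he, fun k hkk ↦ hk (fun _ ↦ k) fun _ ↦ hkk⟩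

/-- **Reduction of `eventually_approxHasRasmussen_multiIndex` to multi-count strip stability in
general position** (and Reidemeister's theorem): every core-missing model knot `K` is the start of a
collared family of core-missing model knots ending at a knot `K'` in general position
(`IsModelKnot.exists_isotopy_inGeneralPosition`), along which null-homology and all
`s(D(k⃗)(τ^ε ∘ ·))`, `s(D(k⃗)(·))` are transported
(`approxHasRasmussen_beltTwist_comp_iff_of_isotopy`); then the squeeze for `K'`.
[cite: ManolescuMarengonSarkarWillis2023, Thm. 3.7, Thm. 3.3 and §8.1] -/
theorem eventually_approxHasRasmussen_multiIndex_of_multiStripStable_inGeneralPosition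
    (hR : Knot.reidemeister)
    (h : ∀ {r : ℕ} {K : 𝕊 1 → 𝔼 4}, 0 < r → IsModelKnot r K → IsNullHomologous r K →
      (∀ t, wC (K t) ≠ 0) → (∃ K₃ : Knot, ⇑K₃ = finiteApprox r 0 K ∧ K₃.InGeneralPosition) →
        ∃ (w : ℝ) (e : Fin r → ℝ) (s k₀ : ℤ), 0 < w ∧ (∀ j, |e j| + w < 1) ∧
          ∀ κ : Fin r → ℤ, (∀ j, k₀ ≤ κ j) →
            ApproxHasRasmussen r 0 (stripTwistAtMulti r κ w e ∘ K) s) :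
    eventually_approxHasRasmussen_multiIndex := by
  rw [eventually_approxHasRasmussen_multiIndex_iff]
  intro r K hK h0 hwK ε
  rcases Nat.eq_zero_or_pos r with rfl | hr
  · exact ⟨0, fun k _ s ↦ approxHasRasmussen_beltTwist_comp_iff_zero_left K ε k s⟩
  obtain ⟨H, K₃', hH, hH0, hH1, hmk, hwH, hpic, hgp⟩ := hK.exists_isotopy_inGeneralPosition hwK
  have hiso : IsSmoothModelIsotopy r K (H 1) := ⟨H, hH, hH0, fun s hs ↦ hH1 s hs, hmk⟩
  obtain ⟨w, e, s₀, k₀, hw, he, hk⟩ :=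
    h hr (hmk 1) (hiso.isNullHomologous h0) (hwH 1) ⟨K₃', hpic, hgp⟩
  obtain ⟨k₁, hk₁⟩ := exists_forall_approxHasRasmussen_beltTwist_comp_iff_of_multiStripStable hR
    (hmk 1) (hwH 1) hw he hk ε
  refine ⟨k₁, fun k hkk s ↦ ?_⟩
  rw [approxHasRasmussen_beltTwist_comp_iff_of_isotopy hH (hH0 0 le_rfl) rfl hmk hwH ε k s,
    approxHasRasmussen_iff_of_isotopy hH (hH0 0 le_rfl) rfl hmk hwH k s]
  exact hk₁ k hkk s

/-! ## Robust forms: single-valuedness of `s` in `S³` as the hypothesis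

The only use of Reidemeister's theorem above is the single-valuedness of the Rasmussen invariant
of a knot in `S³` (`ApproxHasRasmussen.unique`).  The variants below take that single-valuedness
itself as the hypothesis `hS` — the form in which any corrected version of the tree's fact
`Knot.reidemeister` (cf. the discussion of its move set in `GaussDiagramsRMoves.lean`) will supply
it. -/

/-- **Two Rasmussen invariants of the same finite approximation agree** as soon as the Rasmussen
invariant of a knot in `S³` is single-valued (hypothesis `hS`, Rasmussen (2010), Thm. 1; in the
tree from `Knot.reidemeister` through `Knot.existsUnique_hasRasmussenInvariant`): the two tree
knots carrying the picture have the same underlying map, hence coincide.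
[cite: Rasmussen2010, Thm. 1] -/
theorem ApproxHasRasmussen.unique_of_hasRasmussenInvariant_unique
    (hS : ∀ {K₃ : Knot} {s s' : ℤ}, K₃.HasRasmussenInvariant s → K₃.HasRasmussenInvariant s' → s = s')
    {K : 𝕊 1 → 𝔼 4} {k s s' : ℤ} (h : ApproxHasRasmussen r k K s)
    (h' : ApproxHasRasmussen r k K s') : s = s' := by
  obtain ⟨K₃, hK₃, hs⟩ := h
  obtain ⟨K₃', hK₃', hs'⟩ := h'
  obtain rfl : K₃ = K₃' := DFunLike.coe_injective (hK₃.trans hK₃'.symm)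
  exact hS hs hs'

/-- **The squeeze, for one knot, over single-valuedness of `s` in `S³`** (robust form of
`exists_forall_approxHasRasmussen_beltTwist_comp_iff_of_multiStripStable`).
[cite: ManolescuMarengonSarkarWillis2023, Thm. 3.7 and Thm. 3.3] -/
theorem exists_forall_approxHasRasmussen_beltTwist_comp_iff_of_multiStripStable_of_unique
    (hS : ∀ {K₃ : Knot} {s s' : ℤ}, K₃.HasRasmussenInvariant s → K₃.HasRasmussenInvariant s' → s = s')
    {K : 𝕊 1 → 𝔼 4} (hK : IsModelKnot r K) (hwK : ∀ t, wC (K t) ≠ 0)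
    {w : ℝ} (hw : 0 < w) {e : Fin r → ℝ} (he : ∀ j, |e j| + w < 1) {s₀ k₀ : ℤ}
    (hk : ∀ κ : Fin r → ℤ, (∀ j, k₀ ≤ κ j) →
      ApproxHasRasmussen r 0 (stripTwistAtMulti r κ w e ∘ K) s₀)
    (ε : Fin r → ℤ) :
    ∃ k₁ : ℤ, ∀ k : ℤ, k₁ ≤ k → ∀ s : ℤ,
      ApproxHasRasmussen r k (beltTwist r ε ∘ K) s ↔ ApproxHasRasmussen r k K s := by
  refine ⟨k₀ + ∑ j, |ε j|, fun k hkk s ↦ ?_⟩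
  have hsum : (0 : ℤ) ≤ ∑ i, |ε i| := Finset.sum_nonneg fun i _ ↦ abs_nonneg (ε i)
  have hκ₁ : ∀ j, k₀ ≤ (ε + fun _ ↦ k : Fin r → ℤ) j := fun j ↦ by
    have h1 : |ε j| ≤ ∑ i, |ε i| :=
      Finset.single_le_sum (f := fun i ↦ |ε i|) (fun i _ ↦ abs_nonneg (ε i)) (Finset.mem_univ j)
    have h2 : -|ε j| ≤ ε j := neg_abs_le _
    simp only [Pi.add_apply]
    linarith
  have hκ₂ : ∀ j : Fin r, k₀ ≤ (fun _ : Fin r ↦ k) j := fun j ↦ by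
    show k₀ ≤ k
    linarith
  have hA : ApproxHasRasmussen r 0 (stripTwistAtMulti r (ε + fun _ ↦ k) w e ∘ K) s₀ := hk _ hκ₁
  have hB : ApproxHasRasmussen r 0 (stripTwistAtMulti r (fun _ ↦ k) w e ∘ K) s₀ := hk _ hκ₂
  rw [approxHasRasmussen_beltTwist_comp_iff_stripTwistAtMulti_add hK hwK ε hw he k s,
    approxHasRasmussen_iff_stripTwistAtMulti_const hK hwK hw he k s]
  exact ⟨fun h ↦ by rw [h.unique_of_hasRasmussenInvariant_unique hS hA]; exact hB,
    fun h ↦ by rw [h.unique_of_hasRasmussenInvariant_unique hS hB]; exact hA⟩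

/-- **Reduction of `eventually_approxHasRasmussen_multiIndex` to multi-count strip stability and
single-valuedness of `s` in `S³`** (robust form of
`eventually_approxHasRasmussen_multiIndex_of_multiStripStable`).
[cite: ManolescuMarengonSarkarWillis2023, Thm. 3.7, Thm. 3.3 and Thm. 2.8 (proof)] -/
theorem eventually_approxHasRasmussen_multiIndex_of_multiStripStable_of_unique
    (hS : ∀ {K₃ : Knot} {s s' : ℤ}, K₃.HasRasmussenInvariant s → K₃.HasRasmussenInvariant s' → s = s')
    (h : ∀ {r : ℕ} {K : 𝕊 1 → 𝔼 4}, 0 < r → IsModelKnot r K → IsNullHomologous r K →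
      (∀ t, wC (K t) ≠ 0) →
        ∃ (w : ℝ) (e : Fin r → ℝ) (s k₀ : ℤ), 0 < w ∧ (∀ j, |e j| + w < 1) ∧
          ∀ κ : Fin r → ℤ, (∀ j, k₀ ≤ κ j) →
            ApproxHasRasmussen r 0 (stripTwistAtMulti r κ w e ∘ K) s) :
    eventually_approxHasRasmussen_multiIndex := by
  rw [eventually_approxHasRasmussen_multiIndex_iff]
  intro r K hK h0 hwK ε
  rcases Nat.eq_zero_or_pos r with rfl | hr
  · exact ⟨0, fun k _ s ↦ approxHasRasmussen_beltTwist_comp_iff_zero_left K ε k s⟩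
  obtain ⟨w, e, s₀, k₀, hw, he, hk⟩ := h hr hK h0 hwK
  exact exists_forall_approxHasRasmussen_beltTwist_comp_iff_of_multiStripStable_of_unique hS hK hwK
    hw he hk ε

/-- **Reduction of `eventually_approxHasRasmussen_multiIndex` to multi-count strip stability in
general position and single-valuedness of `s` in `S³`** (robust form of
`eventually_approxHasRasmussen_multiIndex_of_multiStripStable_inGeneralPosition`).
[cite: ManolescuMarengonSarkarWillis2023, Thm. 3.7, Thm. 3.3 and §8.1] -/
theorem eventually_approxHasRasmussen_multiIndex_of_multiStripStable_inGeneralPosition_of_unique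
    (hS : ∀ {K₃ : Knot} {s s' : ℤ}, K₃.HasRasmussenInvariant s → K₃.HasRasmussenInvariant s' → s = s')
    (h : ∀ {r : ℕ} {K : 𝕊 1 → 𝔼 4}, 0 < r → IsModelKnot r K → IsNullHomologous r K →
      (∀ t, wC (K t) ≠ 0) → (∃ K₃ : Knot, ⇑K₃ = finiteApprox r 0 K ∧ K₃.InGeneralPosition) →
        ∃ (w : ℝ) (e : Fin r → ℝ) (s k₀ : ℤ), 0 < w ∧ (∀ j, |e j| + w < 1) ∧
          ∀ κ : Fin r → ℤ, (∀ j, k₀ ≤ κ j) →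
            ApproxHasRasmussen r 0 (stripTwistAtMulti r κ w e ∘ K) s) :
    eventually_approxHasRasmussen_multiIndex := by
  rw [eventually_approxHasRasmussen_multiIndex_iff]
  intro r K hK h0 hwK ε
  rcases Nat.eq_zero_or_pos r with rfl | hr
  · exact ⟨0, fun k _ s ↦ approxHasRasmussen_beltTwist_comp_iff_zero_left K ε k s⟩
  obtain ⟨H, K₃', hH, hH0, hH1, hmk, hwH, hpic, hgp⟩ := hK.exists_isotopy_inGeneralPosition hwK
  have hiso : IsSmoothModelIsotopy r K (H 1) := ⟨H, hH, hH0, fun s hs ↦ hH1 s hs, hmk⟩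
  obtain ⟨w, e, s₀, k₀, hw, he, hk⟩ :=
    h hr (hmk 1) (hiso.isNullHomologous h0) (hwH 1) ⟨K₃', hpic, hgp⟩
  obtain ⟨k₁, hk₁⟩ :=
    exists_forall_approxHasRasmussen_beltTwist_comp_iff_of_multiStripStable_of_unique hS (hmk 1)
      (hwH 1) hw he hk ε
  refine ⟨k₁, fun k hkk s ↦ ?_⟩
  rw [approxHasRasmussen_beltTwist_comp_iff_of_isotopy hH (hH0 0 le_rfl) rfl hmk hwH ε k s,
    approxHasRasmussen_iff_of_isotopy hH (hH0 0 le_rfl) rfl hmk hwH k s]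
  exact hk₁ k hkk s

/-- The tree's Reidemeister fact supplies the single-valuedness hypothesis `hS` of the robust forms
(through `Knot.existsUnique_hasRasmussenInvariant`, with the proved facts
`Knot.exists_hasGaussDiagram_of_isIsotopic` and `GaussDiagram.rasmussenInvariant_eq_of_equiv`).
[cite: Rasmussen2010, Thm. 1] -/
theorem hasRasmussenInvariant_unique_of_reidemeister (hR : Knot.reidemeister) {K₃ : Knot} {s s' : ℤ}
    (h : K₃.HasRasmussenInvariant s) (h' : K₃.HasRasmussenInvariant s') : s = s' :=
  (Knot.existsUnique_hasRasmussenInvariant Knot.exists_hasGaussDiagram_of_isIsotopic_holds hR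
    GaussDiagram.rasmussenInvariant_eq_of_equiv_holds K₃).unique h h'

end MMSW

end Literature.Topology.FourManifolds

end
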